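import Literature.AlgebraicGeometry.Frobenioids.BiratUnitsTransport
import HarnessLib

/-!
# [FrdI] Prop. 2.2 (ii) for `C^birat`: intertwining algebra — powers, inverses, generators, roots

Mochizuki, *The geometry of Frobenioids I: the general theory*, Kyushu J. Math. **62** (2008)
293–400, §2 Proposition 2.2 (ii)(a) p. 45 (the rational function monoid `A ↦ O^×(A^birat)` as a
functor on `D`: its value on a linear morphism "is the inclusion of Proposition 1.11, (iv)"), §1
Proposition 1.11 (iv) p. 36 (that inclusion is "uniquely determined by the condition that
`O^⊳(A) ∋ α ↦ β ∈ O^⊳(B)` implies `α ∘ φ = φ ∘ β`" — the intertwining relation used below), §4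
Prop. 4.4 (ii)–(iv) p. 83 [cite: MochizukiFrdI2008, Prop. 2.2(ii) p.45].  Used by [FrdII] Thm. 3.6 (i)
(kurims p. 36): the identification `(Φ^fld)^pf(Base X) ≅ O^×(X^birat)` of the rational function monoid of
`C^ℚ = C^pf` must be NATURAL along linear arrows — an intertwining statement for two homomorphisms out
of a perfection, which this file reduces to generators [cite: MochizukiFrdII2008, Thm 3.6 (i) p.36]
(abc-iut cell, layer L1, row M13-c3 FILE B-generic piece (4), for L1-t6's FILE B-arch (S3); seat
abc-iut-w5-d194).

Over `BiratUnits.Intertwines` / `Intertwines.mul` / `Intertwines.one` (`BiratUnitsIntertwines.lean`) and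
`transportHom` / `intertwines_iff_eq_transportHom` (`BiratUnitsTransport.lean`):
* `Intertwines.pow`, `Intertwines.inv`, `Intertwines.div`, `Intertwines.zpow` — intertwined pairs form
  a subgroup `intertwinedSubgroup ψ ≤ O^×(A^birat) × O^×(A'^birat)`;
* `intertwines_of_forall_mem_closure` — two homomorphisms `g : S → O^×(A^birat)`,
  `g' : S → O^×(A'^birat)` intertwined on a generating set of the monoid `S` are intertwined everywhere;
* `Intertwines.of_pow` — for LINEAR `ψ` (isotropic type) and `O^×(A^birat)` with injective power maps,
  `ψ ∘ uⁿ = vⁿ ∘ ψ ⇒ ψ ∘ u = v ∘ ψ` (uniqueness of the transport + uniqueness of roots);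
* `intertwines_perfection_of_forall_of` — **intertwining of two homomorphisms out of a perfection
  `P^pf` is checked on `P`** (same hypotheses);
* root-injectivity bookkeeping: `injective_pow_of_mulEquiv`, `injective_pow_prod`,
  `injective_pow_of_isPerfect` (so that `O^×(A^birat) ≃ O^×(A) × Φ^birat(A)` with perfect factors has
  injective power maps).
Classical; no statement of the paper is strengthened; nothing here bears on [IUTchIII].
-/

namespace Literature.AlgebraicGeometry.Frobenioids

open CategoryTheory Opposite Function

/-! ### Root-injectivity bookkeeping (generic) -/

section PowInjective

/-- Injectivity of the `n`-th power map transports along a multiplicative isomorphism.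
(folklore) [cite: MochizukiFrdI2008, §0 p.11] -/
theorem injective_pow_of_mulEquiv {B B' : Type*} [Monoid B] [Monoid B'] (e : B ≃* B') {n : ℕ}
    (h : Injective fun y : B' => y ^ n) : Injective fun x : B => x ^ n := by
  intro x y hxy
  have h' : e x ^ n = e y ^ n := by
    have := congrArg e hxy
    simpa only [map_pow] using this
  exact e.injective (h h')

/-- The `n`-th power map of a product is injective if it is on both factors.
(folklore) [cite: MochizukiFrdI2008, §0 p.11] -/
theorem injective_pow_prod {U G : Type*} [Monoid U] [Monoid G] {n : ℕ}
    (hU : Injective fun u : U => u ^ n) (hG : Injective fun g : G => g ^ n) :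
    Injective fun x : U × G => x ^ n := by
  rintro ⟨u, g⟩ ⟨u', g'⟩ h
  have h1 : u ^ n = u' ^ n := congrArg Prod.fst h
  have h2 : g ^ n = g' ^ n := congrArg Prod.snd h
  exact Prod.ext (hU h1) (hG h2)

/-- A perfect commutative monoid has injective power maps (`n ≥ 1`). [cite: MochizukiFrdI2008, §0 p.11] -/
theorem injective_pow_of_isPerfect {M : Type*} [CommMonoid M] (hM : IsPerfect M) {n : ℕ} (hn : 0 < n) :
    Injective fun a : M => a ^ n :=
  (hM.bijective_pow n hn).1

end PowInjective

namespace PreFrobenioid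

namespace BiratUnits

universe w v v' u u'

variable {D : Type u} [Category.{v} D] {Φ : Dᵒᵖ ⥤ CommMonCat.{w}}
  {C : Type u'} [Category.{v'} C] {F : C ⥤ ElemFrobenioid Φ} {hF : IsFrobenioid F}
  {hsq : HasBiratSquares F} {A A' : C}

/-! ### Intertwined pairs form a subgroup -/

/-- Intertwining is compatible with powers: `ψ ∘ u = v ∘ ψ ⇒ ψ ∘ uⁿ = vⁿ ∘ ψ`.
[cite: MochizukiFrdI2008, Prop. 2.2(ii) p.45] -/
theorem Intertwines.pow (hsq : HasBiratSquares F) {ψ : A ⟶ A'} {u : BiratUnits F hF A}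
    {v : BiratUnits F hF A'} (h : Intertwines hF ψ u v) (n : ℕ) : Intertwines hF ψ (u ^ n) (v ^ n) := by
  induction n with
  | zero => rw [pow_zero, pow_zero]; exact Intertwines.one hsq ψ
  | succ n ih => rw [pow_succ, pow_succ]; exact ih.mul hsq h

/-- Intertwining is compatible with inverses: `ψ ∘ u = v ∘ ψ ⇒ ψ ∘ u⁻¹ = v⁻¹ ∘ ψ` (conjugate the
commuting square in `C^birat` by the automorphisms `u`, `v`). [cite: MochizukiFrdI2008, Prop. 2.2(ii) p.45] -/
theorem Intertwines.inv (hsq : HasBiratSquares F) {ψ : A ⟶ A'} {u : BiratUnits F hF A}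
    {v : BiratUnits F hF A'} (h : Intertwines hF ψ u v) : Intertwines hF ψ u⁻¹ v⁻¹ := by
  rw [intertwines_iff_toHom_comm hsq] at h ⊢
  calc toHom hsq u⁻¹ ≫ (toBirat F hF hsq).map ψ
      = toHom hsq u⁻¹ ≫ (toBirat F hF hsq).map ψ ≫ toHom hsq v ≫ toHom hsq v⁻¹ := by
        rw [toHom_comp_inv, Category.comp_id]
    _ = toHom hsq u⁻¹ ≫ (toHom hsq u ≫ (toBirat F hF hsq).map ψ) ≫ toHom hsq v⁻¹ := by
        rw [h, Category.assoc]
    _ = (toHom hsq u⁻¹ ≫ toHom hsq u) ≫ (toBirat F hF hsq).map ψ ≫ toHom hsq v⁻¹ := by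
        simp only [Category.assoc]
    _ = (toBirat F hF hsq).map ψ ≫ toHom hsq v⁻¹ := by rw [toHom_inv_comp, Category.id_comp]

/-- Intertwining is compatible with quotients. [cite: MochizukiFrdI2008, Prop. 2.2(ii) p.45] -/
theorem Intertwines.div (hsq : HasBiratSquares F) {ψ : A ⟶ A'} {u₁ u₂ : BiratUnits F hF A}
    {v₁ v₂ : BiratUnits F hF A'} (h₁ : Intertwines hF ψ u₁ v₁) (h₂ : Intertwines hF ψ u₂ v₂) :
    Intertwines hF ψ (u₁ / u₂) (v₁ / v₂) := by
  rw [div_eq_mul_inv, div_eq_mul_inv]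
  exact h₁.mul hsq (h₂.inv hsq)

/-- Intertwining is compatible with integer powers. [cite: MochizukiFrdI2008, Prop. 2.2(ii) p.45] -/
theorem Intertwines.zpow (hsq : HasBiratSquares F) {ψ : A ⟶ A'} {u : BiratUnits F hF A}
    {v : BiratUnits F hF A'} (h : Intertwines hF ψ u v) (n : ℤ) : Intertwines hF ψ (u ^ n) (v ^ n) := by
  cases n with
  | ofNat n => rw [Int.ofNat_eq_natCast, zpow_natCast, zpow_natCast]; exact h.pow hsq n
  | negSucc n => rw [zpow_negSucc, zpow_negSucc]; exact (h.pow hsq (n + 1)).inv hsq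

variable (hF) in
/-- The intertwined pairs `(u, v)`, `ψ ∘ u = v ∘ ψ`, as a subgroup of `O^×(A^birat) × O^×(A'^birat)`.
[cite: MochizukiFrdI2008, Prop. 2.2(ii) p.45] -/
def intertwinedSubgroup (hsq : HasBiratSquares F) (ψ : A ⟶ A') :
    Subgroup (BiratUnits F hF A × BiratUnits F hF A') where
  carrier := {x | Intertwines hF ψ x.1 x.2}
  mul_mem' ha hb := Intertwines.mul hsq ha hb
  one_mem' := Intertwines.one hsq ψ
  inv_mem' ha := Intertwines.inv hsq ha

/-- Membership in `intertwinedSubgroup`. [cite: MochizukiFrdI2008, Prop. 2.2(ii) p.45] -/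
@[simp] theorem mem_intertwinedSubgroup (hsq : HasBiratSquares F) (ψ : A ⟶ A')
    (x : BiratUnits F hF A × BiratUnits F hF A') :
    x ∈ intertwinedSubgroup hF hsq ψ ↔ Intertwines hF ψ x.1 x.2 := Iff.rfl

/-! ### Intertwining of homomorphisms is checked on generators -/

/-- Two homomorphisms `g : S → O^×(A^birat)`, `g' : S → O^×(A'^birat)` out of a monoid `S` that are
intertwined along `ψ` on a set generating `S` are intertwined on all of `S`.
[cite: MochizukiFrdI2008, Prop. 2.2(ii) p.45] -/
theorem intertwines_of_forall_mem_closure (hsq : HasBiratSquares F) {ψ : A ⟶ A'} {S : Type*}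
    [Monoid S] (g : S →* BiratUnits F hF A) (g' : S →* BiratUnits F hF A') {T : Set S}
    (hT : Submonoid.closure T = ⊤) (h : ∀ s ∈ T, Intertwines hF ψ (g s) (g' s)) (s : S) :
    Intertwines hF ψ (g s) (g' s) := by
  have hs : s ∈ Submonoid.closure T := by rw [hT]; exact Submonoid.mem_top s
  induction hs using Submonoid.closure_induction with
  | mem x hx => exact h x hx
  | one => rw [map_one, map_one]; exact Intertwines.one hsq ψ
  | mul x y _ _ hx hy => rw [map_mul, map_mul]; exact hx.mul hsq hy

/-! ### Along linear arrows: roots and perfections -/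

/-- **Intertwining descends along powers** for a LINEAR `ψ` of a Frobenioid of isotropic type when
`O^×(A^birat)` has an injective `n`-th power map: `ψ ∘ uⁿ = vⁿ ∘ ψ ⇒ ψ ∘ u = v ∘ ψ` (the transported
unit is unique, Prop. 2.2 (ii), and `transportHom` is a homomorphism). [cite: MochizukiFrdI2008, Prop. 2.2(ii) p.45] -/
theorem Intertwines.of_pow (hsq : HasBiratSquares F) (hiso : IsOfIsotropicType F) {ψ : A ⟶ A'}
    (hψ : IsLinear F ψ) {n : ℕ}
    (hinj : Injective fun x : BiratUnits F hF A => x ^ n) {u : BiratUnits F hF A}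
    {v : BiratUnits F hF A'} (h : Intertwines hF ψ (u ^ n) (v ^ n)) : Intertwines hF ψ u v := by
  rw [intertwines_iff_eq_transportHom (hsq := hsq) hiso ψ hψ] at h ⊢
  rw [map_pow] at h
  exact hinj h

/-- **Intertwining of two homomorphisms out of a perfection is checked on `P ⊆ P^pf`**: for linear `ψ`
(isotropic type), `O^×(A^birat)` with injective power maps, and homomorphisms
`g : P^pf → O^×(A^birat)`, `g' : P^pf → O^×(A'^birat)` intertwined on the classes of elements of `P`,
`g b` and `g' b` are intertwined for every `b ∈ P^pf` (apply `Intertwines.of_pow` to `bⁿ ∈ P`).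
[cite: MochizukiFrdI2008, Prop. 2.2(ii) p.45] -/
theorem intertwines_perfection_of_forall_of (hsq : HasBiratSquares F) (hiso : IsOfIsotropicType F)
    {ψ : A ⟶ A'} (hψ : IsLinear F ψ) (hinj : ∀ n : ℕ, 0 < n → Injective fun x : BiratUnits F hF A => x ^ n)
    {P : Type*} [CommMonoid P] (g : Perfection P →* BiratUnits F hF A)
    (g' : Perfection P →* BiratUnits F hF A')
    (h : ∀ p : P, Intertwines hF ψ (g (Perfection.of P p)) (g' (Perfection.of P p)))
    (b : Perfection P) : Intertwines hF ψ (g b) (g' b) := by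
  obtain ⟨⟨p, n⟩, rfl⟩ := Perfection.mk_surjective b
  refine Intertwines.of_pow hsq hiso hψ (hinj n n.pos) ?_
  dsimp only
  rw [← map_pow, ← map_pow, Perfection.mk_pow_self]
  exact h p

/-- Variant with the roles of the generating statement packaged as homomorphisms INTO the product: a
homomorphism `S → O^×(A^birat) × O^×(A'^birat)` lands in `intertwinedSubgroup ψ` as soon as it does on
generators. [cite: MochizukiFrdI2008, Prop. 2.2(ii) p.45] -/
theorem range_le_intertwinedSubgroup_of_closure (hsq : HasBiratSquares F) {ψ : A ⟶ A'} {S : Type*}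
    [Group S] (g : S →* BiratUnits F hF A × BiratUnits F hF A') {T : Set S}
    (hT : Subgroup.closure T = ⊤) (h : ∀ s ∈ T, Intertwines hF ψ (g s).1 (g s).2) :
    g.range ≤ intertwinedSubgroup hF hsq ψ := by
  rintro _ ⟨s, rfl⟩
  have hs : s ∈ Subgroup.closure T := by rw [hT]; exact Subgroup.mem_top s
  induction hs using Subgroup.closure_induction with
  | mem x hx => exact h x hx
  | one => rw [map_one]; exact (intertwinedSubgroup hF hsq ψ).one_mem
  | mul x y _ _ hx hy => rw [map_mul]; exact (intertwinedSubgroup hF hsq ψ).mul_mem hx hy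
  | inv x _ hx => rw [map_inv]; exact (intertwinedSubgroup hF hsq ψ).inv_mem hx

end BiratUnits

end PreFrobenioid

end Literature.AlgebraicGeometry.Frobenioids
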